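import Summits.ABC.IUTFork.Repair.RHToptKnapsackDual
import HarnessLib

/-!
# R-H ROUND 4 row R4-8 «D1 DUAL LAW» — when the deficit ratio is monotone in the label, the FORCED WEIGHT LAW of the as-posed knapsack is a
# LABEL CUT-OFF (PROOF-ONLY, 0 definitions)

abc-iut cell, rung LADDER-ABC:A2.RESCUE.H; seat abc-iut-rh2-xi-2 (KEY R4DUAL-B, engine B of census row O-16; desk abc-iut-rh-lead, referee rh-ref-1). Sequel of
`Repair/RHToptKnapsackDual.lean` (p488805) §3 `forcedLaw_of_optimal` / `forced_one_of_lt_ratio` / `forced_zero_of_ratio_lt`: there, every optimal scheme of the LP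
    (P) maximise `Σ_{c∈s} ω c·t c` over `0 ≤ ω ≤ 1` subject to `Σ_{c∈s} ω c·ŝ c ≥ 0`
is `1` on deficit cells (`ŝ c < 0`) of RATIO `t c/(−ŝ c) > y` and `0` on those of ratio `< y`, `y` the certificate's multiplier. WHAT IS ADDED HERE (§1): if the cells are
LABELLED by a linear order and the ratio is STRICTLY DECREASING in the label across the deficit cells, the threshold in the ratio is a threshold in the LABEL — in every
optimal scheme a deficit cell that is not dropped (`ω k ≠ 0`) forces every SMALLER deficit label to be kept whole (`forced_one_of_lt_of_ne_zero`), and a deficit cell that is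
not kept whole (`ω j ≠ 1`) forces every LARGER deficit label to be dropped (`forced_zero_of_lt_of_ne_one`); hence at most ONE deficit label carries a fractional weight
(`fractional_unique`), the kept deficit labels are downward closed (`kept_downClosed`) and the dropped ones upward closed (`dropped_upClosed`). This is the shape the two
R4-8 engines tabulate on the beds of record (engine B, ROUND4/R4-8-DUAL-LAW-rh2-xi-2.md: the ratio `(j²−1)m_q/u_j` is strictly decreasing in `j` over the unlicensed labels on
1014/1014 · 3392/3392 · 509/509 places of FREY133 · FREY482 · HEX79, so the forced law is the initial-segment truncation `ω⋆(w,·) = 𝟙{j ≤ j_y(w)} + θ_w·𝟙{j = j_y(w)+1}` there;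
worked place FREY `p = 7`, `l = 107`: `Repair/RHToptKnapsackAsPosedPlace.lean`, `j_y = 46`). The monotonicity itself is a per-place arithmetic fact certified by the tables
(computed ≠ proved), NOT asserted here: this file is the generic implication only.
HONEST FRAMING: elementary LP arithmetic over a linearly ordered field; nothing here asserts that abc is proved or refuted, or that [IUTchIII] Cor. 3.12 / [IUTchIV]
Thm. 1.10 holds or fails at any datum, or takes a side on any author; typed ≠ proved. [folklore] (fractional knapsack, Dantzig 1957).
-/

namespace Summit.ABC.IUTFork.Repair.RH.ToptKnapsack

open Finset

variable {ι 𝕜 : Type*} [LinearOrder ι] [Field 𝕜] [LinearOrder 𝕜] [IsStrictOrderedRing 𝕜]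

/-! ## §1. Monotone ratio ⟹ the forced law is a cut-off in the label -/

section LabelCut

variable {s : Finset ι} {t ŝ ω ω' : ι → 𝕜} {y : 𝕜}

/-- **Kept-whole below any non-dropped deficit label.** Let `(ω⋆, y)` be a certificate (feasible, `y ≥ 0`, complementary slackness) and `ω` any optimal feasible scheme,
as in `forcedLaw_of_optimal`. If the deficit ratio `t/(−ŝ)` is strictly decreasing in the label across deficit cells of `s`, then for deficit labels `j < k` in `s`:
`ω k ≠ 0 ⟹ ω j = 1`. (Reason: `ω k ≠ 0` forces `ratio k ≥ y`, hence `ratio j > y`.) [folklore] -/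
theorem forced_one_of_lt_of_ne_zero (h0' : ∀ c ∈ s, 0 ≤ ω' c) (h1' : ∀ c ∈ s, ω' c ≤ 1) (hnet' : 0 ≤ ∑ c ∈ s, ω' c * ŝ c)
    (hy : 0 ≤ y) (htight : y * ∑ c ∈ s, ω' c * ŝ c = 0)
    (hcs : ∀ c ∈ s, (0 < t c + y * ŝ c → ω' c = 1) ∧ (t c + y * ŝ c < 0 → ω' c = 0))
    (h0 : ∀ c ∈ s, 0 ≤ ω c) (h1 : ∀ c ∈ s, ω c ≤ 1) (hnet : 0 ≤ ∑ c ∈ s, ω c * ŝ c)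
    (hopt : ∑ c ∈ s, ω' c * t c ≤ ∑ c ∈ s, ω c * t c)
    (hanti : ∀ j ∈ s, ∀ k ∈ s, ŝ j < 0 → ŝ k < 0 → j < k → t k / (-ŝ k) < t j / (-ŝ j))
    {j k : ι} (hj : j ∈ s) (hk : k ∈ s) (hsj : ŝ j < 0) (hsk : ŝ k < 0) (hjk : j < k) (hωk : ω k ≠ 0) :
    ω j = 1 := by
  have hyk : y ≤ t k / (-ŝ k) := by
    by_contra hlt
    exact hωk (forced_zero_of_ratio_lt h0' h1' hnet' hy htight hcs h0 h1 hnet hopt hk hsk (lt_of_not_ge hlt))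
  exact forced_one_of_lt_ratio h0' h1' hnet' hy htight hcs h0 h1 hnet hopt hj hsj (lt_of_le_of_lt hyk (hanti j hj k hk hsj hsk hjk))

/-- **Dropped above any not-wholly-kept deficit label.** Same hypotheses; for deficit labels `j < k` in `s`: `ω j ≠ 1 ⟹ ω k = 0`. (Reason: `ω j ≠ 1` forces
`ratio j ≤ y`, hence `ratio k < y`.) [folklore] -/
theorem forced_zero_of_lt_of_ne_one (h0' : ∀ c ∈ s, 0 ≤ ω' c) (h1' : ∀ c ∈ s, ω' c ≤ 1) (hnet' : 0 ≤ ∑ c ∈ s, ω' c * ŝ c)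
    (hy : 0 ≤ y) (htight : y * ∑ c ∈ s, ω' c * ŝ c = 0)
    (hcs : ∀ c ∈ s, (0 < t c + y * ŝ c → ω' c = 1) ∧ (t c + y * ŝ c < 0 → ω' c = 0))
    (h0 : ∀ c ∈ s, 0 ≤ ω c) (h1 : ∀ c ∈ s, ω c ≤ 1) (hnet : 0 ≤ ∑ c ∈ s, ω c * ŝ c)
    (hopt : ∑ c ∈ s, ω' c * t c ≤ ∑ c ∈ s, ω c * t c)
    (hanti : ∀ j ∈ s, ∀ k ∈ s, ŝ j < 0 → ŝ k < 0 → j < k → t k / (-ŝ k) < t j / (-ŝ j))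
    {j k : ι} (hj : j ∈ s) (hk : k ∈ s) (hsj : ŝ j < 0) (hsk : ŝ k < 0) (hjk : j < k) (hωj : ω j ≠ 1) :
    ω k = 0 := by
  have hyj : t j / (-ŝ j) ≤ y := by
    by_contra hlt
    exact hωj (forced_one_of_lt_ratio h0' h1' hnet' hy htight hcs h0 h1 hnet hopt hj hsj (lt_of_not_ge hlt))
  exact forced_zero_of_ratio_lt h0' h1' hnet' hy htight hcs h0 h1 hnet hopt hk hsk (lt_of_lt_of_le (hanti j hj k hk hsj hsk hjk) hyj)

/-- **At most one fractional deficit label.** Same hypotheses; if two deficit labels `j, k ∈ s` both carry a weight different from `0` and from `1` then `j = k` — the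
«one fractional label» of the greedy law, now located in the LABEL order. [folklore] -/
theorem fractional_unique (h0' : ∀ c ∈ s, 0 ≤ ω' c) (h1' : ∀ c ∈ s, ω' c ≤ 1) (hnet' : 0 ≤ ∑ c ∈ s, ω' c * ŝ c)
    (hy : 0 ≤ y) (htight : y * ∑ c ∈ s, ω' c * ŝ c = 0)
    (hcs : ∀ c ∈ s, (0 < t c + y * ŝ c → ω' c = 1) ∧ (t c + y * ŝ c < 0 → ω' c = 0))
    (h0 : ∀ c ∈ s, 0 ≤ ω c) (h1 : ∀ c ∈ s, ω c ≤ 1) (hnet : 0 ≤ ∑ c ∈ s, ω c * ŝ c)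
    (hopt : ∑ c ∈ s, ω' c * t c ≤ ∑ c ∈ s, ω c * t c)
    (hanti : ∀ j ∈ s, ∀ k ∈ s, ŝ j < 0 → ŝ k < 0 → j < k → t k / (-ŝ k) < t j / (-ŝ j))
    {j k : ι} (hj : j ∈ s) (hk : k ∈ s) (hsj : ŝ j < 0) (hsk : ŝ k < 0)
    (hωj0 : ω j ≠ 0) (hωj1 : ω j ≠ 1) (hωk0 : ω k ≠ 0) (hωk1 : ω k ≠ 1) : j = k := by
  rcases lt_trichotomy j k with hlt | heq | hgt
  · exact absurd (forced_zero_of_lt_of_ne_one h0' h1' hnet' hy htight hcs h0 h1 hnet hopt hanti hj hk hsj hsk hlt hωj1) hωk0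
  · exact heq
  · exact absurd (forced_zero_of_lt_of_ne_one h0' h1' hnet' hy htight hcs h0 h1 hnet hopt hanti hk hj hsk hsj hgt hωk1) hωj0

/-- **The kept deficit set is DOWNWARD CLOSED in the label** (set form of `forced_one_of_lt_of_ne_zero`): for deficit labels `j ≤ k` in `s`, `ω k = 1 ⟹ ω j = 1`.
Together with `forced_one_of_surplus` (licensed cells with mass are kept whole) this is the INITIAL-SEGMENT shape of the dual law when, as on the beds of record, the
licensed labels precede the unlicensed ones. [folklore] -/
theorem kept_downClosed (h0' : ∀ c ∈ s, 0 ≤ ω' c) (h1' : ∀ c ∈ s, ω' c ≤ 1) (hnet' : 0 ≤ ∑ c ∈ s, ω' c * ŝ c)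
    (hy : 0 ≤ y) (htight : y * ∑ c ∈ s, ω' c * ŝ c = 0)
    (hcs : ∀ c ∈ s, (0 < t c + y * ŝ c → ω' c = 1) ∧ (t c + y * ŝ c < 0 → ω' c = 0))
    (h0 : ∀ c ∈ s, 0 ≤ ω c) (h1 : ∀ c ∈ s, ω c ≤ 1) (hnet : 0 ≤ ∑ c ∈ s, ω c * ŝ c)
    (hopt : ∑ c ∈ s, ω' c * t c ≤ ∑ c ∈ s, ω c * t c)
    (hanti : ∀ j ∈ s, ∀ k ∈ s, ŝ j < 0 → ŝ k < 0 → j < k → t k / (-ŝ k) < t j / (-ŝ j))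
    {j k : ι} (hj : j ∈ s) (hk : k ∈ s) (hsj : ŝ j < 0) (hsk : ŝ k < 0) (hjk : j ≤ k) (hωk : ω k = 1) :
    ω j = 1 := by
  rcases hjk.lt_or_eq with hlt | heq
  · exact forced_one_of_lt_of_ne_zero h0' h1' hnet' hy htight hcs h0 h1 hnet hopt hanti hj hk hsj hsk hlt (by rw [hωk]; exact one_ne_zero)
  · rw [heq]; exact hωk

/-- **The dropped deficit set is UPWARD CLOSED in the label**: for deficit labels `j ≤ k` in `s`, `ω j = 0 ⟹ ω k = 0`. [folklore] -/
theorem dropped_upClosed (h0' : ∀ c ∈ s, 0 ≤ ω' c) (h1' : ∀ c ∈ s, ω' c ≤ 1) (hnet' : 0 ≤ ∑ c ∈ s, ω' c * ŝ c)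
    (hy : 0 ≤ y) (htight : y * ∑ c ∈ s, ω' c * ŝ c = 0)
    (hcs : ∀ c ∈ s, (0 < t c + y * ŝ c → ω' c = 1) ∧ (t c + y * ŝ c < 0 → ω' c = 0))
    (h0 : ∀ c ∈ s, 0 ≤ ω c) (h1 : ∀ c ∈ s, ω c ≤ 1) (hnet : 0 ≤ ∑ c ∈ s, ω c * ŝ c)
    (hopt : ∑ c ∈ s, ω' c * t c ≤ ∑ c ∈ s, ω c * t c)
    (hanti : ∀ j ∈ s, ∀ k ∈ s, ŝ j < 0 → ŝ k < 0 → j < k → t k / (-ŝ k) < t j / (-ŝ j))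
    {j k : ι} (hj : j ∈ s) (hk : k ∈ s) (hsj : ŝ j < 0) (hsk : ŝ k < 0) (hjk : j ≤ k) (hωj : ω j = 0) :
    ω k = 0 := by
  rcases hjk.lt_or_eq with hlt | heq
  · exact forced_zero_of_lt_of_ne_one h0' h1' hnet' hy htight hcs h0 h1 hnet hopt hanti hj hk hsj hsk hlt (by rw [hωj]; exact zero_ne_one)
  · rw [← heq]; exact hωj

end LabelCut

end Summit.ABC.IUTFork.Repair.RH.ToptKnapsack
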